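import Literature.NumberTheory.EllipticCurves.SwanConductorTorsionDichotomyProofs
import Literature.NumberTheory.EllipticCurves.VariableChangePointsMap
import HarnessLib

/-!
# The wild conductor `Sw_𝔓(V_ℓ E)` is invariant under a change of Weierstrass equation over `K`

`Proofs` file (theorems only, no definitions, no named facts), landed by the seat of bsd.S15
(`Literature.NumberTheory.EllipticCurves.conductorNorm_eq_artinConductorNat_of_isElliptic`) as
glue for the per-type assembly of Ogg's formula at `p = 3` (the normal forms of Tate's algorithm
live on a model `C • E`, the conductor is that of `E`):

* `WeierstrassCurve.exists_smul_geomTorsion_ne_iff_variableChange` — `σ ∈ Γ_K` moves a point of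
  `(C • E)[ℓ]` iff it moves a point of `E[ℓ]` (the bijection `E(K̄) ≃+ (C • E)(K̄)` of
  `VariableChange.pointEquivBaseChange` is `Γ_K`-equivariant and additive);
* `WeierstrassCurve.swanConductorAt_rationalTate_variableChange` — **`Sw_𝔓(V_ℓ(C • E)) =
  Sw_𝔓(V_ℓ E)`** for `v ∤ ℓ`, `𝔓 ∣ v`: both sides are `2 · vol{u > 0 : Γ_K^u(𝔓) moves E[ℓ]}`
  (`swanConductorAt_rationalTate_eq_two_mul_volume`, `SwanConductorTorsionDichotomyProofs`).

No definitions, no named facts.  All axioms `propext`, `Classical.choice`, `Quot.sound`.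

## References

* J. H. Silverman, *Advanced Topics in the Arithmetic of Elliptic Curves*, GTM 151 (1994), IV.§10
  (the conductor of `E/K`; invariance under isomorphism is implicit in the definition via
  `V_ℓ(E)`); *AEC* III.3.1(b). [SilvermanATAEC1994] [SilvermanAEC2009]
-/

noncomputable section

open scoped Classical NumberField
open Field IsDedekindDomain

universe u

namespace WeierstrassCurve

open Literature.NumberTheory.EllipticCurves Literature.NumberTheory.GaloisRepresentations
  IsDedekindDomain.HeightOneSpectrum

variable {K : Type u} [Field K] [NumberField K] (W : WeierstrassCurve K) (C : VariableChange K)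

omit [NumberField K] in
/-- The `Γ_K`-equivariant bijection `E(K̄) ≃ E'(K̄)`, `E' = C • E`, identifies the elements of
`Γ_K` moving some `ℓ`-torsion point. [folklore] -/
theorem exists_smul_geomTorsion_ne_iff_variableChange (ℓ : ℕ) (σ : absoluteGaloisGroup K) :
    (∃ T : geomTorsion (C • W) ℓ, σ • T ≠ T) ↔ ∃ T : geomTorsion W ℓ, σ • T ≠ T := by
  let e : geomPoints W ≃+ geomPoints (C • W) :=
    VariableChange.pointEquivBaseChange W C (AlgebraicClosure K)
  have hsmul : ∀ (P : geomPoints W), e (σ • P) = σ • e P := fun P ↦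
    VariableChange.pointEquivBaseChange_map_algEquiv W C (absoluteGaloisGroup.toAlgEquiv K σ) P
  have htor : ∀ {P : geomPoints W}, P ∈ geomTorsion W ℓ ↔ e P ∈ geomTorsion (C • W) ℓ := by
    intro P
    rw [geomTorsion, geomTorsion, AddSubgroup.torsionBy.nsmul_iff, AddSubgroup.torsionBy.nsmul_iff,
      ← map_nsmul, AddEquiv.map_eq_zero_iff]
  constructor
  · rintro ⟨T, hT⟩
    refine ⟨⟨e.symm (T : geomPoints (C • W)), ?_⟩, fun h ↦ hT (Subtype.ext ?_)⟩
    · rw [htor, AddEquiv.apply_symm_apply]; exact T.2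
    · have h' := congrArg (fun P : geomTorsion W ℓ ↦ e (P : geomPoints W)) h
      simp only at h'
      change e (σ • e.symm (T : geomPoints (C • W))) = e (e.symm T) at h'
      rw [hsmul, AddEquiv.apply_symm_apply] at h'
      exact h'
  · rintro ⟨T, hT⟩
    refine ⟨⟨e (T : geomPoints W), htor.mp T.2⟩, fun h ↦ hT (Subtype.ext ?_)⟩
    have h' := congrArg (fun P : geomTorsion (C • W) ℓ ↦ (P : geomPoints (C • W))) h
    change σ • e (T : geomPoints W) = e T at h'
    rw [← hsmul] at h'
    exact e.injective h'

/-- **The wild part of the conductor does not depend on the Weierstrass equation.**  For an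
elliptic curve `E/K` over a number field, a change of variables `C` over `K`, a prime `ℓ`, a
finite place `v ∤ ℓ` and `𝔓 ∣ v`: `Sw_𝔓(V_ℓ(C • E)) = Sw_𝔓(V_ℓ E)`.  Both equal
`2 · vol{u > 0 : Γ_K^u(𝔓) moves E[ℓ]}` (`swanConductorAt_rationalTate_eq_two_mul_volume`), and
`E[ℓ] ≃ (C • E)[ℓ]` `Γ_K`-equivariantly (`VariableChange.pointEquivBaseChange`).  Silverman *AEC*
III.3.1(b), VII.1.3; *ATAEC* IV.§10 (the conductor is an isogeny, a fortiori isomorphism,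
invariant). [cite: SilvermanATAEC1994, IV.§10 (definition of the conductor)] -/
theorem swanConductorAt_rationalTate_variableChange (ℓ : ℕ) [Fact ℓ.Prime] [W.IsElliptic]
    (h : Continuous fun x : absoluteGaloisGroup K × RationalTateModule (geomPoints W) ℓ ↦
      rationalTateRepresentation (absoluteGaloisGroup K) (geomPoints W) ℓ x.1 x.2)
    (h' : Continuous fun x : absoluteGaloisGroup K × RationalTateModule (geomPoints (C • W)) ℓ ↦
      rationalTateRepresentation (absoluteGaloisGroup K) (geomPoints (C • W)) ℓ x.1 x.2)
    {v : HeightOneSpectrum (𝓞 K)} (hℓ : (ℓ : 𝓞 K) ∉ v.asIdeal)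
    {𝔓 : Ideal (absIntegers (𝓞 K) K)} (h𝔓 : 𝔓 ∈ v.primesAbove) :
    (rationalTateGaloisRepOf (geomPoints (C • W)) ℓ h').swanConductorAt (𝓞 K) 𝔓 =
      (rationalTateGaloisRepOf (geomPoints W) ℓ h).swanConductorAt (𝓞 K) 𝔓 := by
  rw [(C • W).swanConductorAt_rationalTate_eq_two_mul_volume ℓ h' hℓ h𝔓,
    W.swanConductorAt_rationalTate_eq_two_mul_volume ℓ h hℓ h𝔓]
  congr 3
  ext u
  refine and_congr_right fun _ ↦ ⟨?_, ?_⟩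
  · rintro ⟨σ, hσ, hT⟩
    exact ⟨σ, hσ, (W.exists_smul_geomTorsion_ne_iff_variableChange C ℓ σ).mp hT⟩
  · rintro ⟨σ, hσ, hT⟩
    exact ⟨σ, hσ, (W.exists_smul_geomTorsion_ne_iff_variableChange C ℓ σ).mpr hT⟩

end WeierstrassCurve

end
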